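import Mathlib
import HarnessLib

/-!
# Submultiplicativity of sumset cardinalities (Gyarmati–Matolcsi–Ruzsa 2010, Theorem 1.2;
# three summands: Ruzsa 2007) and the discrete Loomis–Whitney inequality (their Lemma 3.1)

Topic `Literature/Combinatorics/Additive`.  Cell `mm-stpp` (D-0046), seat `mm-stpp-lit` (gen 7);
companion of `SumsetSuperadditivity.lean` (Theorem 1.1 of the same paper).

**Theorem (Gyarmati–Matolcsi–Ruzsa 2010, Thm 1.2; for three summands Ruzsa 2007, Thm 5.1).**  "Let
`A_1, …, A_k` be finite, nonempty sets in an arbitrary commutative semigroup.  Put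
`S = A_1 + ⋯ + A_k`, `S_i = Σ_{j ≠ i} A_j`.  We have `|S| ≤ (∏ |S_i|)^{1/(k−1)}`" — here `k = 3`:
`|A + B + C|² ≤ |A + B|·|A + C|·|B + C|` (`card_add_add_sq_le`, any additive commutative semigroup).

**Lemma (GMR 2010, Lemma 3.1, `d = 3`; Loomis–Whitney / Han / Bollobás–Thomason box theorem).**
"`|B|^{d−1} ≤ ∏ |B_i|`" for a finite `B ⊆ X_1 × ⋯ × X_d` and its coordinate-deleting projections
`B_i` — here `d = 3`: `card_sq_le_card_proj_mul`.

PROOF, as printed (§3): Lemma 3.1 by induction on `d` (slice by the first coordinate, the `d = 2`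
bound `|B(x)| ≤ |B(x)_2||B(x)_3|`, `|B(x)| ≤ |B_1|`, then Hölder — for `d = 3` Cauchy–Schwarz in the
Sedrakyan form `(Σ t_x)²/Σ p_x ≤ Σ t_x²/p_x`); Theorem 1.2 by sending `s ∈ S` to its
lexicographically least representation `f(s) ∈ A × B × C` (lexicographic in a fixed enumeration of
`A ∪ B ∪ C`, encoded as a base-`M` integer), applying Lemma 3.1 to `f(S)`, and checking that on each
projection of `f(S)` the coordinate sum is injective (a collision would produce a lexicographically
smaller representation).
WHAT THIS FILE IS NOT: not the non-commutative question of GMR §1, not Theorem 1.4 (PROVED since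
2026-08-27 in the sibling file `RestrictedSumsetSubmultiplicativity.lean`, seat `mm-stpp-lit` gen 11).

**Any number of summands (appended 2026-08-27, seat `mm-stpp-lit` gen 8 — the former
TODO(general form) of this file).**  Lemma 3.1 for every dimension `d = n + 1`:
`LoomisWhitney.pow_card_le_prod_card_image_removeNth` — for `B ⊆ X^{n+1}` (`Finset (Fin (n+1) → X)`,
`n ≥ 1`) with projections `B_i = B.image (Fin.removeNth i)`, `|B|^n ≤ ∏_i |B_i|` (and the `Nonempty`
form `…_of_nonempty` for every `n`); proof as printed (induction on `d`, slicing along the first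
coordinate, Hölder), the Hölder step being `LoomisWhitney.pow_sum_le_mul_prod_sum` — "if
`t_x^m ≤ C ∏_{j∈J} q_j(x)` (`|J| = m`) then `(∑_x t_x)^m ≤ C ∏_j ∑_x q_j(x)`" — proved from Mathlib's
weighted AM–GM inequality `NNReal.geom_mean_le_arith_mean_weighted`.  Theorem 1.2 for every
`k = n + 1`: `pow_card_sum_le_prod_card_sum_succAbove` — for nonempty `A : Fin (n+1) → Finset α` in an
additive commutative monoid, `|∑_i A_i|^n ≤ ∏_i |∑_j A_{i.succAbove j}|` (and `…_sum_erase` with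
`S_i = ∑_{j ∈ {i}ᶜ} A_j`); proof as printed: the lexicographically least representation `f(s)` (lex
order `Pi.Lex` on the rank vectors for a fixed enumeration of `⋃ A_i`), `B = f(S)`, Lemma 3.1, and on
each projection `B_j` the coordinate sum is injective — a collision `z ≠ z'` gives the representation
`update (f s) j (f s' j)` of `s'` (resp. `update (f s') j (f s j)` of `s`), one of which is
lexicographically smaller than the least one (`LoomisWhitney.toLex_update_lt_toLex_update`
transports the comparison along the common `j`-th coordinate).  (GMR state Thm 1.2 for commutative
semigroups; a commutative semigroup embeds in a commutative monoid by adjoining a zero, so the monoid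
form loses nothing — it is what makes `∑ i, A i` available.)
(Former TODO(general form) — GMR 2010 Thm 1.4, `|S + A|² ≤ |S||A + B₁||A + B₂|` for `S ⊆ B₁ + B₂` —
is DONE: `Literature.Combinatorics.Additive.card_add_sq_le_card_mul_card_add_mul_card_add` in
`RestrictedSumsetSubmultiplicativity.lean`, with GMR §4 Thms 4.1–4.3 for two summands.)

## References
* K. Gyarmati, M. Matolcsi, I. Z. Ruzsa, *A superadditivity and submultiplicativity property for
  cardinalities of sumsets*, Combinatorica 30 (2010) 163–174, Thm 1.2, Lemma 3.1, §3 — held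
  `paper:arxiv-0707.2707`, chunks p0003, p0006 read 2026-08-27 (re-read in full for the
  general case, gen 8) [cite: GyarmatiMatolcsiRuzsa2010, Thm 1.2].
* L. H. Loomis, H. Whitney, *An inequality related to the isoperimetric inequality*, Bull. Amer.
  Math. Soc. 55 (1949) 961–962; T. S. Han, *Nonnegative entropy measures of multivariate symmetric
  correlations*, Inform. Control 36 (1978); B. Bollobás, A. Thomason, *Projections of bodies and
  hereditary properties of hypergraphs*, Bull. London Math. Soc. 27 (1995) — the sources GMR name
  for Lemma 3.1 ("This lemma is not new"); cited from GMR, not held.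
* I. Z. Ruzsa, *Cardinality questions about sumsets*, in: Additive Combinatorics (CRM Proc. 43,
  2007), Thm 5.1 (three summands; cited from GMR 2010, not held).
-/

namespace Literature.Combinatorics.Additive

open Finset
open scoped Pointwise

/-! ### Lemma 3.1 for `d = 3` (discrete Loomis–Whitney) -/

section LoomisWhitney

variable {X Y Z : Type*} [DecidableEq X] [DecidableEq Y] [DecidableEq Z]

/-- **GMR 2010, Lemma 3.1 (`d = 3`).**  For a finite `T ⊆ X × Y × Z` with projections
`T₂₃, T₁₃, T₁₂` (delete the first, second, third coordinate): `|T|² ≤ |T₂₃|·|T₁₃|·|T₁₂|`.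
[cite: GyarmatiMatolcsiRuzsa2010, Lemma 3.1] -/
theorem card_sq_le_card_proj_mul (T : Finset (X × Y × Z)) :
    #T ^ 2 ≤ #(T.image Prod.snd) * #(T.image fun t => (t.1, t.2.2)) *
      #(T.image fun t => (t.1, t.2.1)) := by
  classical
  set N := #(T.image Prod.snd) with hN
  set X₀ := T.image Prod.fst with hX₀
  set Tx : X → Finset (X × Y × Z) := fun x => T.filter (fun t => t.1 = x) with hTx
  set p : X → ℕ := fun x => #((Tx x).image fun t => t.2.1) with hp
  set q : X → ℕ := fun x => #((Tx x).image fun t => t.2.2) with hq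
  -- `|T| = Σ_x |T_x|`
  have hT : #T = ∑ x ∈ X₀, #(Tx x) :=
    card_eq_sum_card_fiberwise fun t ht => mem_coe.2 (mem_image_of_mem _ (mem_coe.1 ht))
  -- `|T_x| ≤ N`
  have h1 : ∀ x, #(Tx x) ≤ N := by
    intro x
    refine card_le_card_of_injOn Prod.snd (fun t ht => ?_) fun t ht t' ht' h => ?_
    · exact mem_coe.2 (mem_image_of_mem _ (mem_filter.1 (mem_coe.1 ht)).1)
    · rw [mem_coe, hTx, mem_filter] at ht ht'
      exact Prod.ext (ht.2.trans ht'.2.symm) h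
  -- `|T_x| ≤ p_x q_x` (the case `d = 2`)
  have h2 : ∀ x, #(Tx x) ≤ p x * q x := by
    intro x
    have e : #(Tx x) = #((Tx x).image Prod.snd) := by
      rw [card_image_of_injOn fun t ht t' ht' h => ?_]
      rw [mem_coe, hTx, mem_filter] at ht ht'
      exact Prod.ext (ht.2.trans ht'.2.symm) h
    rw [e]
    refine (card_le_card subset_product).trans ?_
    rw [card_product, image_image, image_image]
    rfl
  -- `Σ_x p_x = |T₁₂|`, `Σ_x q_x = |T₁₃|`
  have h3 : ∑ x ∈ X₀, p x = #(T.image fun t => (t.1, t.2.1)) := by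
    rw [card_eq_sum_card_fiberwise (s := T.image fun t => (t.1, t.2.1)) (t := X₀) (f := Prod.fst)
      fun u hu => ?_]
    · refine sum_congr rfl fun x _ => ?_
      rw [filter_image]
      have e1 : T.filter (fun t => ((t.1, t.2.1) : X × Y).1 = x) = Tx x :=
        filter_congr fun t _ => Iff.rfl
      have e2 : (Tx x).image (fun t => (t.1, t.2.1)) =
          ((Tx x).image fun t => t.2.1).image (fun y => (x, y)) := by
        rw [image_image]
        refine image_congr fun t ht => ?_
        rw [mem_coe, hTx, mem_filter] at ht
        simp only [Function.comp]
        rw [ht.2]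
      rw [e1, e2, card_image_of_injective _ (Prod.mk_right_injective x)]
    · rw [mem_coe, mem_image] at hu
      obtain ⟨t, ht, rfl⟩ := hu
      exact mem_coe.2 (mem_image_of_mem _ ht)
  have h4 : ∑ x ∈ X₀, q x = #(T.image fun t => (t.1, t.2.2)) := by
    rw [card_eq_sum_card_fiberwise (s := T.image fun t => (t.1, t.2.2)) (t := X₀) (f := Prod.fst)
      fun u hu => ?_]
    · refine sum_congr rfl fun x _ => ?_
      rw [filter_image]
      have e1 : T.filter (fun t => ((t.1, t.2.2) : X × Z).1 = x) = Tx x :=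
        filter_congr fun t _ => Iff.rfl
      have e2 : (Tx x).image (fun t => (t.1, t.2.2)) =
          ((Tx x).image fun t => t.2.2).image (fun z => (x, z)) := by
        rw [image_image]
        refine image_congr fun t ht => ?_
        rw [mem_coe, hTx, mem_filter] at ht
        simp only [Function.comp]
        rw [ht.2]
      rw [e1, e2, card_image_of_injective _ (Prod.mk_right_injective x)]
    · rw [mem_coe, mem_image] at hu
      obtain ⟨t, ht, rfl⟩ := hu
      exact mem_coe.2 (mem_image_of_mem _ ht)
  -- Cauchy–Schwarz (Sedrakyan form) over `ℝ`
  rcases X₀.eq_empty_or_nonempty with h0 | hne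
  · rw [hT, h0, sum_empty]; simp
  have hp_pos : ∀ x ∈ X₀, (0 : ℝ) < p x := by
    intro x hx
    rw [hX₀, mem_image] at hx
    obtain ⟨t, ht, rfl⟩ := hx
    have : (Tx t.1).Nonempty := ⟨t, mem_filter.2 ⟨ht, rfl⟩⟩
    exact_mod_cast card_pos.2 (this.image _)
  have hsp : (0 : ℝ) < ∑ x ∈ X₀, (p x : ℝ) := sum_pos hp_pos hne
  have hCS := sq_sum_div_le_sum_sq_div X₀ (fun x => (#(Tx x) : ℝ)) hp_pos
  have hterm : ∀ x ∈ X₀, ((#(Tx x) : ℝ)) ^ 2 / p x ≤ N * q x := by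
    intro x hx
    rw [div_le_iff₀ (hp_pos x hx)]
    have e1 : (#(Tx x) : ℝ) ≤ N := by exact_mod_cast h1 x
    have e2 : (#(Tx x) : ℝ) ≤ p x * q x := by exact_mod_cast h2 x
    have e3 : (0 : ℝ) ≤ #(Tx x) := by positivity
    nlinarith
  have hsum : (∑ x ∈ X₀, (#(Tx x) : ℝ)) ^ 2 ≤ N * (∑ x ∈ X₀, (q x : ℝ)) * ∑ x ∈ X₀, (p x : ℝ) := by
    have := hCS.trans (sum_le_sum hterm)
    rw [← mul_sum, div_le_iff₀ hsp] at this
    exact this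
  have : ((#T : ℕ) : ℝ) ^ 2 ≤ (N : ℝ) * #(T.image fun t => (t.1, t.2.2)) *
      #(T.image fun t => (t.1, t.2.1)) := by
    rw [hT, ← h3, ← h4]
    push_cast
    exact hsum
  exact_mod_cast this

end LoomisWhitney

/-! ### Theorem 1.2 for three summands -/

namespace Submult

/-- Base-`M` encoding of a triple of digits is strictly monotone in the lexicographic order: first
digit. [folklore] -/
private theorem key_lt_of_lt₁ {M r₁ r₂ r₃ r₁' r₂' r₃' : ℕ} (h₂ : r₂ < M) (h₃ : r₃ < M)
    (h : r₁ < r₁') : (r₁ * M + r₂) * M + r₃ < (r₁' * M + r₂') * M + r₃' := by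
  have : (r₁ * M + r₂) * M + r₃ < (r₁ + 1) * M * M := by nlinarith
  have h' : (r₁ + 1) * M * M ≤ (r₁' * M + r₂') * M + r₃' :=
    calc (r₁ + 1) * M * M ≤ r₁' * M * M :=
          Nat.mul_le_mul_right _ (Nat.mul_le_mul_right _ h)
      _ ≤ (r₁' * M + r₂') * M := Nat.mul_le_mul_right _ (Nat.le_add_right _ _)
      _ ≤ (r₁' * M + r₂') * M + r₃' := Nat.le_add_right _ _
  omega

/-- Base-`M` encoding: second digit. [folklore] -/
private theorem key_lt_of_lt₂ {M r₁ r₂ r₃ r₂' r₃' : ℕ} (h₃ : r₃ < M) (h : r₂ < r₂') :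
    (r₁ * M + r₂) * M + r₃ < (r₁ * M + r₂') * M + r₃' := by
  have : (r₁ * M + r₂) * M + r₃ < (r₁ * M + r₂ + 1) * M := by nlinarith
  have h' : (r₁ * M + r₂ + 1) * M ≤ (r₁ * M + r₂') * M + r₃' := by nlinarith
  omega

end Submult

open Submult in
/-- **Gyarmati–Matolcsi–Ruzsa 2010, Theorem 1.2 for `k = 3` (Ruzsa 2007, Thm 5.1).**  For finite
sets `A, B, C` in an additive commutative semigroup: `|A + B + C|² ≤ |A + B|·|A + C|·|B + C|`.
[cite: GyarmatiMatolcsiRuzsa2010, Thm 1.2] -/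
theorem card_add_add_sq_le {α : Type*} [AddCommSemigroup α] [DecidableEq α] (A B C : Finset α) :
    #(A + B + C) ^ 2 ≤ #(A + B) * #(A + C) * #(B + C) := by
  classical
  -- an enumeration of `A ∪ B ∪ C` and the base-`M` key of a triple
  set U := A ∪ B ∪ C with hU
  set M := #U + 1 with hM
  set rk : α → ℕ := fun u => if h : u ∈ U then (U.equivFin ⟨u, h⟩ : ℕ) else 0 with hrk
  have hrkM : ∀ u, rk u < M := by
    intro u
    simp only [hrk]
    split_ifs with h
    · exact (U.equivFin ⟨u, h⟩).isLt.trans (by omega)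
    · omega
  have hrk_inj : ∀ {u v}, u ∈ U → v ∈ U → rk u = rk v → u = v := by
    intro u v hu hv h
    simp only [hrk, dif_pos hu, dif_pos hv] at h
    have := (U.equivFin).injective (Fin.ext h)
    exact congrArg Subtype.val this
  set key : α × α × α → ℕ := fun t => (rk t.1 * M + rk t.2.1) * M + rk t.2.2 with hkey
  -- representations and the least one
  set S := A + B + C with hS
  set R : α → Finset (α × α × α) :=
    fun s => (A ×ˢ (B ×ˢ C)).filter (fun t => t.1 + t.2.1 + t.2.2 = s) with hR
  have hRne : ∀ s ∈ S, (R s).Nonempty := by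
    intro s hs
    rw [hS, mem_add] at hs
    obtain ⟨ab, hab, c, hc, rfl⟩ := hs
    obtain ⟨a, ha, b, hb, rfl⟩ := mem_add.1 hab
    exact ⟨(a, b, c), mem_filter.2 ⟨mem_product.2 ⟨ha, mem_product.2 ⟨hb, hc⟩⟩, rfl⟩⟩
  have hex : ∀ s ∈ S, ∃ t ∈ R s, ∀ t' ∈ R s, key t ≤ key t' :=
    fun s hs => exists_min_image (R s) key (hRne s hs)
  choose! f hfR hfmin using hex
  have hmemR : ∀ {s t}, t ∈ R s ↔ (t.1 ∈ A ∧ t.2.1 ∈ B ∧ t.2.2 ∈ C) ∧ t.1 + t.2.1 + t.2.2 = s := by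
    intro s t
    simp only [hR, mem_filter, mem_product, and_assoc]
  have hAU : ∀ {a}, a ∈ A → a ∈ U := fun h => by rw [hU]; exact mem_union_left _ (mem_union_left _ h)
  have hBU : ∀ {b}, b ∈ B → b ∈ U := fun h => by rw [hU]; exact mem_union_left _ (mem_union_right _ h)
  have hCU : ∀ {c}, c ∈ C → c ∈ U := fun h => by rw [hU]; exact mem_union_right _ h
  -- the set `T = f(S)` has `|T| = |S|`
  set T := S.image f with hT
  have hTcard : #T = #S := by
    rw [hT, card_image_of_injOn fun s hs s' hs' h => ?_]
    have h1 := (hmemR.1 (hfR s (mem_coe.1 hs))).2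
    have h2 := (hmemR.1 (hfR s' (mem_coe.1 hs'))).2
    rw [← h1, ← h2, h]
  -- facts about `f s` for `s ∈ S`
  have hf : ∀ s ∈ S, ((f s).1 ∈ A ∧ (f s).2.1 ∈ B ∧ (f s).2.2 ∈ C) ∧
      (f s).1 + (f s).2.1 + (f s).2.2 = s := fun s hs => hmemR.1 (hfR s hs)
  -- no representation of `s` has a smaller key than `f s`
  have hnolt : ∀ s ∈ S, ∀ t, t ∈ R s → ¬ key t < key (f s) :=
    fun s hs t ht hlt => absurd (hfmin s hs t ht) (not_le.2 hlt)
  -- unpacking an element of a projection of `T`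
  have hT' : ∀ {t}, t ∈ T → ∃ s ∈ S, f s = t := fun ht => by
    rw [hT, mem_image] at ht; exact ht
  -- projection `T₁₂ → A + B` is injective on sums
  have h12 : #(T.image fun t => (t.1, t.2.1)) ≤ #(A + B) := by
    refine card_le_card_of_injOn (fun u => u.1 + u.2) (fun u hu => ?_) fun u hu u' hu' huu => ?_
    · rw [mem_coe, mem_image] at hu
      obtain ⟨t, ht, rfl⟩ := hu
      obtain ⟨s, hs, rfl⟩ := hT' ht
      exact mem_coe.2 (add_mem_add (hf s hs).1.1 (hf s hs).1.2.1)
    · rw [mem_coe, mem_image] at hu hu'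
      obtain ⟨t, ht, rfl⟩ := hu
      obtain ⟨t', ht', rfl⟩ := hu'
      obtain ⟨s, hs, rfl⟩ := hT' ht
      obtain ⟨s', hs', rfl⟩ := hT' ht'
      obtain ⟨⟨ha, hb, hc⟩, hsum⟩ := hf s hs
      obtain ⟨⟨ha', hb', hc'⟩, hsum'⟩ := hf s' hs'
      change (f s).1 + (f s).2.1 = (f s').1 + (f s').2.1 at huu
      -- the mixed representations `(a, b, c′)` of `s′` and `(a′, b′, c)` of `s`
      have hmix : ((f s).1, (f s).2.1, (f s').2.2) ∈ R s' :=
        hmemR.2 ⟨⟨ha, hb, hc'⟩, show (f s).1 + (f s).2.1 + (f s').2.2 = s' by rw [huu, hsum']⟩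
      have hmix' : ((f s').1, (f s').2.1, (f s).2.2) ∈ R s :=
        hmemR.2 ⟨⟨ha', hb', hc⟩, show (f s').1 + (f s').2.1 + (f s).2.2 = s by rw [← huu, hsum]⟩
      rcases lt_trichotomy (rk (f s).1) (rk (f s').1) with h1 | h1 | h1
      · exact (hnolt s' hs' _ hmix (by
          simp only [hkey]; exact key_lt_of_lt₁ (hrkM _) (hrkM _) h1)).elim
      · rcases lt_trichotomy (rk (f s).2.1) (rk (f s').2.1) with h2 | h2 | h2
        · exact (hnolt s' hs' _ hmix (by
            simp only [hkey, h1]; exact key_lt_of_lt₂ (hrkM _) h2)).elim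
        · exact Prod.ext (hrk_inj (hAU ha) (hAU ha') h1) (hrk_inj (hBU hb) (hBU hb') h2)
        · exact (hnolt s hs _ hmix' (by
            simp only [hkey, ← h1]; exact key_lt_of_lt₂ (hrkM _) h2)).elim
      · exact (hnolt s hs _ hmix' (by
          simp only [hkey]; exact key_lt_of_lt₁ (hrkM _) (hrkM _) h1)).elim
  -- projection `T₁₃ → A + C`
  have h13 : #(T.image fun t => (t.1, t.2.2)) ≤ #(A + C) := by
    refine card_le_card_of_injOn (fun u => u.1 + u.2) (fun u hu => ?_) fun u hu u' hu' huu => ?_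
    · rw [mem_coe, mem_image] at hu
      obtain ⟨t, ht, rfl⟩ := hu
      obtain ⟨s, hs, rfl⟩ := hT' ht
      exact mem_coe.2 (add_mem_add (hf s hs).1.1 (hf s hs).1.2.2)
    · rw [mem_coe, mem_image] at hu hu'
      obtain ⟨t, ht, rfl⟩ := hu
      obtain ⟨t', ht', rfl⟩ := hu'
      obtain ⟨s, hs, rfl⟩ := hT' ht
      obtain ⟨s', hs', rfl⟩ := hT' ht'
      obtain ⟨⟨ha, hb, hc⟩, hsum⟩ := hf s hs
      obtain ⟨⟨ha', hb', hc'⟩, hsum'⟩ := hf s' hs'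
      change (f s).1 + (f s).2.2 = (f s').1 + (f s').2.2 at huu
      -- `a + b′ + c = a′ + b′ + c′ = s′` and `a′ + b + c′ = s`
      have e1 : (f s).1 + (f s').2.1 + (f s).2.2 = s' :=
        calc (f s).1 + (f s').2.1 + (f s).2.2 = (f s).1 + (f s).2.2 + (f s').2.1 := add_right_comm _ _ _
          _ = (f s').1 + (f s').2.2 + (f s').2.1 := by rw [huu]
          _ = (f s').1 + (f s').2.1 + (f s').2.2 := add_right_comm _ _ _
          _ = s' := hsum'
      have e2 : (f s').1 + (f s).2.1 + (f s').2.2 = s :=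
        calc (f s').1 + (f s).2.1 + (f s').2.2 = (f s').1 + (f s').2.2 + (f s).2.1 := add_right_comm _ _ _
          _ = (f s).1 + (f s).2.2 + (f s).2.1 := by rw [huu]
          _ = (f s).1 + (f s).2.1 + (f s).2.2 := add_right_comm _ _ _
          _ = s := hsum
      have hmix : ((f s).1, (f s').2.1, (f s).2.2) ∈ R s' := hmemR.2 ⟨⟨ha, hb', hc⟩, e1⟩
      have hmix' : ((f s').1, (f s).2.1, (f s').2.2) ∈ R s := hmemR.2 ⟨⟨ha', hb, hc'⟩, e2⟩
      rcases lt_trichotomy (rk (f s).1) (rk (f s').1) with h1 | h1 | h1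
      · exact (hnolt s' hs' _ hmix (by
          simp only [hkey]; exact key_lt_of_lt₁ (hrkM _) (hrkM _) h1)).elim
      · have ha_eq : (f s).1 = (f s').1 := hrk_inj (hAU ha) (hAU ha') h1
        rcases lt_trichotomy (rk (f s).2.2) (rk (f s').2.2) with h3 | h3 | h3
        · exact (hnolt s' hs' _ hmix (by simp only [hkey, h1]; omega)).elim
        · exact Prod.ext ha_eq (hrk_inj (hCU hc) (hCU hc') h3)
        · exact (hnolt s hs _ hmix' (by simp only [hkey, ← h1]; omega)).elim
      · exact (hnolt s hs _ hmix' (by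
          simp only [hkey]; exact key_lt_of_lt₁ (hrkM _) (hrkM _) h1)).elim
  -- projection `T₂₃ → B + C`
  have h23 : #(T.image Prod.snd) ≤ #(B + C) := by
    refine card_le_card_of_injOn (fun u => u.1 + u.2) (fun u hu => ?_) fun u hu u' hu' huu => ?_
    · rw [mem_coe, mem_image] at hu
      obtain ⟨t, ht, rfl⟩ := hu
      obtain ⟨s, hs, rfl⟩ := hT' ht
      exact mem_coe.2 (add_mem_add (hf s hs).1.2.1 (hf s hs).1.2.2)
    · rw [mem_coe, mem_image] at hu hu'
      obtain ⟨t, ht, rfl⟩ := hu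
      obtain ⟨t', ht', rfl⟩ := hu'
      obtain ⟨s, hs, rfl⟩ := hT' ht
      obtain ⟨s', hs', rfl⟩ := hT' ht'
      obtain ⟨⟨ha, hb, hc⟩, hsum⟩ := hf s hs
      obtain ⟨⟨ha', hb', hc'⟩, hsum'⟩ := hf s' hs'
      change (f s).2.1 + (f s).2.2 = (f s').2.1 + (f s').2.2 at huu
      have e1 : (f s').1 + (f s).2.1 + (f s).2.2 = s' := by
        rw [add_assoc, huu, ← add_assoc, hsum']
      have e2 : (f s).1 + (f s').2.1 + (f s').2.2 = s := by
        rw [add_assoc, ← huu, ← add_assoc, hsum]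
      have hmix : ((f s').1, (f s).2.1, (f s).2.2) ∈ R s' := hmemR.2 ⟨⟨ha', hb, hc⟩, e1⟩
      have hmix' : ((f s).1, (f s').2.1, (f s').2.2) ∈ R s := hmemR.2 ⟨⟨ha, hb', hc'⟩, e2⟩
      rcases lt_trichotomy (rk (f s).2.1) (rk (f s').2.1) with h2 | h2 | h2
      · exact (hnolt s' hs' _ hmix (by
          simp only [hkey]; exact key_lt_of_lt₂ (hrkM _) h2)).elim
      · have hb_eq : (f s).2.1 = (f s').2.1 := hrk_inj (hBU hb) (hBU hb') h2
        rcases lt_trichotomy (rk (f s).2.2) (rk (f s').2.2) with h3 | h3 | h3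
        · exact (hnolt s' hs' _ hmix (by simp only [hkey, h2]; omega)).elim
        · exact Prod.ext hb_eq (hrk_inj (hCU hc) (hCU hc') h3)
        · exact (hnolt s hs _ hmix' (by simp only [hkey, ← h2]; omega)).elim
      · exact (hnolt s hs _ hmix' (by
          simp only [hkey]; exact key_lt_of_lt₂ (hrkM _) h2)).elim
  -- assemble with Lemma 3.1
  have hLW := card_sq_le_card_proj_mul T
  rw [hTcard] at hLW
  calc #S ^ 2 ≤ #(T.image Prod.snd) * #(T.image fun t => (t.1, t.2.2)) *
        #(T.image fun t => (t.1, t.2.1)) := hLW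
    _ ≤ #(B + C) * #(A + C) * #(A + B) :=
        Nat.mul_le_mul (Nat.mul_le_mul h23 h13) h12
    _ = #(A + B) * #(A + C) * #(B + C) := by ring


/-! ## Any number of summands (gen 8): Lemma 3.1 for every `d` and Theorem 1.2 for every `k` -/

open scoped NNReal


namespace LoomisWhitney

/-- **Hölder's inequality, the integer form used for the box theorem**: if `t_x^m ≤ C ∏_{j ∈ J} q_j(x)`
for every `x ∈ s`, where `|J| = m ≥ 1`, then `(∑_{x∈s} t_x)^m ≤ C ∏_{j∈J} ∑_{x∈s} q_j(x)`.  (Proof: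
`t_x ≤ C^{1/m} ∏_j Q_j^{1/m} ∏_j (q_j(x)/Q_j)^{1/m}` with `Q_j = ∑_x q_j(x)`, and the weighted AM–GM
inequality `∏_j (q_j(x)/Q_j)^{1/m} ≤ (1/m) ∑_j q_j(x)/Q_j`, whose right side sums to `1` over `x`.)
[cite: GyarmatiMatolcsiRuzsa2010, Lemma 3.1 (proof: "Using this and Hölder's inequality")] -/
theorem pow_sum_le_mul_prod_sum {X ι : Type*} (s : Finset X) (J : Finset ι) {m : ℕ}
    (hJ : #J = m) (hm : m ≠ 0) (C : ℕ) (t : X → ℕ) (q : ι → X → ℕ)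
    (h : ∀ x ∈ s, t x ^ m ≤ C * ∏ j ∈ J, q j x) :
    (∑ x ∈ s, t x) ^ m ≤ C * ∏ j ∈ J, ∑ x ∈ s, q j x := by
  classical
  -- if some `Q_j = ∑_x q_j(x)` vanishes then every `t_x` vanishes
  by_cases hzero : ∃ j ∈ J, ∑ x ∈ s, q j x = 0
  · obtain ⟨j, hj, hQ⟩ := hzero
    have ht : ∀ x ∈ s, t x = 0 := by
      intro x hx
      have hq : q j x = 0 := (sum_eq_zero_iff.1 hQ) x hx
      have := h x hx
      rw [prod_eq_zero hj hq, mul_zero, Nat.le_zero] at this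
      exact (pow_eq_zero_iff hm).1 this
    rw [sum_eq_zero ht, zero_pow hm]
    exact Nat.zero_le _
  push Not at hzero
  -- real exponent `e = 1/m`
  set e : ℝ := (m : ℝ)⁻¹ with he
  have he0 : 0 ≤ e := by positivity
  have hme : (m : ℝ) * e = 1 := by rw [he]; field_simp
  set w : ℝ≥0 := (m : ℝ≥0)⁻¹ with hw
  have hwe : ((w : ℝ≥0) : ℝ) = e := by rw [hw, he]; push_cast; rfl
  have hwsum : ∑ _j ∈ J, w = 1 := by
    rw [sum_const, hJ, nsmul_eq_mul, hw]
    exact mul_inv_cancel₀ (by exact_mod_cast hm)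
  set Q : ι → ℝ≥0 := fun j => ∑ x ∈ s, (q j x : ℝ≥0) with hQ
  have hQne : ∀ j ∈ J, Q j ≠ 0 := by
    intro j hj hQ0
    apply hzero j hj
    have : ((∑ x ∈ s, q j x : ℕ) : ℝ≥0) = 0 := by push_cast; exact hQ0
    exact_mod_cast this
  -- the per-`x` bound
  have hx : ∀ x ∈ s, (t x : ℝ≥0) ≤
      ((C : ℝ≥0) ^ e * ∏ j ∈ J, Q j ^ e) * ∑ j ∈ J, w * ((q j x : ℝ≥0) / Q j) := by
    intro x hxs
    have h1 : (t x : ℝ≥0) = (((t x : ℝ≥0) ^ m)) ^ e := by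
      rw [he, NNReal.pow_rpow_inv_natCast _ hm]
    have h2 : ((t x : ℝ≥0) ^ m) ≤ (C : ℝ≥0) * ∏ j ∈ J, (q j x : ℝ≥0) := by
      exact_mod_cast h x hxs
    have h3 : (((t x : ℝ≥0) ^ m)) ^ e ≤ ((C : ℝ≥0) * ∏ j ∈ J, (q j x : ℝ≥0)) ^ e :=
      NNReal.rpow_le_rpow h2 he0
    have h4' : (∏ j ∈ J, (q j x : ℝ≥0)) ^ e = (∏ j ∈ J, Q j ^ e) * ∏ j ∈ J, ((q j x : ℝ≥0) / Q j) ^ e := by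
      rw [← prod_mul_distrib, ← NNReal.finsetProd_rpow]
      refine prod_congr rfl fun j hj => ?_
      rw [← NNReal.mul_rpow, mul_div_cancel₀ _ (hQne j hj)]
    have h4 : ((C : ℝ≥0) * ∏ j ∈ J, (q j x : ℝ≥0)) ^ e =
        ((C : ℝ≥0) ^ e * ∏ j ∈ J, Q j ^ e) * ∏ j ∈ J, ((q j x : ℝ≥0) / Q j) ^ e := by
      rw [NNReal.mul_rpow, h4', mul_assoc]
    have h5 : ∏ j ∈ J, ((q j x : ℝ≥0) / Q j) ^ e ≤ ∑ j ∈ J, w * ((q j x : ℝ≥0) / Q j) := by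
      have := NNReal.geom_mean_le_arith_mean_weighted J (fun _ => w) (fun j => (q j x : ℝ≥0) / Q j) hwsum
      simpa only [hwe] using this
    rw [h1]
    refine h3.trans ?_
    rw [h4]
    exact mul_le_mul_of_nonneg_left h5 zero_le
  -- sum over `x`
  have hsum : (∑ x ∈ s, (t x : ℝ≥0)) ≤ (C : ℝ≥0) ^ e * ∏ j ∈ J, Q j ^ e := by
    refine (sum_le_sum hx).trans ?_
    rw [← mul_sum, sum_comm]
    have hin : ∑ j ∈ J, ∑ x ∈ s, w * ((q j x : ℝ≥0) / Q j) = 1 := by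
      rw [← hwsum]
      refine sum_congr rfl fun j hj => ?_
      rw [← mul_sum, ← sum_div, div_self (hQne j hj), mul_one]
    rw [hin, mul_one]
  -- raise to the `m`-th power
  have hpow : (∑ x ∈ s, (t x : ℝ≥0)) ^ m ≤ (C : ℝ≥0) * ∏ j ∈ J, Q j := by
    have := pow_le_pow_left₀ zero_le hsum m
    refine this.trans (le_of_eq ?_)
    rw [mul_pow, ← prod_pow, he, NNReal.rpow_inv_natCast_pow _ hm]
    congr 1
    exact prod_congr rfl fun j _ => NNReal.rpow_inv_natCast_pow _ hm
  have : ((∑ x ∈ s, t x) ^ m : ℕ) ≤ ((C * ∏ j ∈ J, ∑ x ∈ s, q j x : ℕ) : ℝ≥0) := by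
    push_cast
    exact hpow
  exact_mod_cast this

/-- Deleting coordinate `j + 1` commutes with splitting off coordinate `0`:
`removeNth (j+1) b = cons (b 0) (removeNth j (tail b))`. [folklore] -/
private theorem removeNth_succ_eq_cons {n : ℕ} {α : Type*} (j : Fin (n + 1)) (b : Fin (n + 2) → α) :
    Fin.removeNth j.succ b = Fin.cons (b 0) (Fin.removeNth j (Fin.tail b)) := by
  ext i
  refine Fin.cases ?_ (fun i => ?_) i
  · simp [Fin.removeNth]
  · simp only [Fin.removeNth, Fin.cons_succ, Fin.tail]
    rw [Fin.succ_succAbove_succ]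

variable {X : Type*} [DecidableEq X]

/-- **Discrete Loomis–Whitney inequality (box theorem), nonempty form, all dimensions `d = n + 1 ≥ 1`**
(Gyarmati–Matolcsi–Ruzsa 2010, Lemma 3.1; Loomis–Whitney 1949; Han 1978; Bollobás–Thomason 1995):
for a finite nonempty `B ⊆ X^{n+1}` with coordinate-deleting projections `B_i = removeNth i '' B`,
`|B|^n ≤ ∏_{i} |B_i|`.  Proof as printed: induction on the dimension, slicing along the first
coordinate (`|B(x)| ≤ |B_1|`, the induction hypothesis on the slice, `B(x)_j =` the `x`-fiber of
`B_{j+1}`) and Hölder's inequality (`pow_sum_le_mul_prod_sum`).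
[cite: GyarmatiMatolcsiRuzsa2010, Lemma 3.1] -/
theorem pow_card_le_prod_card_image_removeNth_of_nonempty :
    ∀ (n : ℕ) (B : Finset (Fin (n + 1) → X)), B.Nonempty →
      #B ^ n ≤ ∏ i : Fin (n + 1), #(B.image (Fin.removeNth i))
  | 0, B, hB => by
    rw [pow_zero, Fin.prod_univ_one]
    exact card_pos.2 (hB.image _)
  | n + 1, B, hB => by
    -- slice along coordinate `0`
    set X₀ : Finset X := B.image fun b => b 0 with hX₀
    set Bx : X → Finset (Fin (n + 2) → X) := fun x => B.filter fun b => b 0 = x with hBx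
    set Tx : X → Finset (Fin (n + 1) → X) := fun x => (Bx x).image Fin.tail with hTx
    have hB_sum : #B = ∑ x ∈ X₀, #(Bx x) :=
      card_eq_sum_card_fiberwise fun b hb => mem_coe.2 (mem_image_of_mem _ (mem_coe.1 hb))
    have hmemBx : ∀ {x b}, b ∈ Bx x ↔ b ∈ B ∧ b 0 = x := fun {x b} => by rw [hBx, mem_filter]
    have hTB : ∀ x, #(Tx x) = #(Bx x) := by
      intro x
      rw [hTx, card_image_of_injOn]
      intro b hb b' hb' h
      rw [mem_coe, hmemBx] at hb hb'
      rw [← Fin.cons_self_tail b, ← Fin.cons_self_tail b', h, hb.2, hb'.2]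
    -- `|B(x)| ≤ |B_0|`
    set N₀ := #(B.image (Fin.removeNth 0)) with hN₀
    have hT_le : ∀ x, #(Tx x) ≤ N₀ := by
      intro x
      refine card_le_card ?_
      rw [hTx, show (Fin.removeNth 0 : (Fin (n + 2) → X) → Fin (n + 1) → X) = Fin.tail from
        funext fun b => Fin.removeNth_zero b]
      exact image_subset_image (filter_subset _ _)
    -- `B(x)_j` is the `x`-fiber of `B_{j+1}`
    set q : Fin (n + 1) → X → ℕ := fun j x =>
      #((B.image (Fin.removeNth j.succ)).filter fun c => c 0 = x) with hq
    have hq_eq : ∀ j x, #((Tx x).image (Fin.removeNth j)) = q j x := by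
      intro j x
      set cx : (Fin n → X) → Fin (n + 1) → X := @Fin.cons n (fun _ => X) x with hcx
      have hinj : Function.Injective cx := Fin.cons_right_injective (α := fun _ => X) x
      set P : Finset (Fin n → X) := (Tx x).image (Fin.removeNth j) with hP
      rw [← card_image_of_injective P hinj]
      change #(P.image cx) = #((B.image (Fin.removeNth j.succ)).filter fun c => c 0 = x)
      congr 1
      ext c
      constructor
      · intro hc
        rw [mem_image] at hc
        obtain ⟨t, ht, rfl⟩ := hc
        rw [hP, mem_image] at ht
        obtain ⟨t', ht', rfl⟩ := ht
        change t' ∈ (Bx x).image Fin.tail at ht'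
        rw [mem_image] at ht'
        obtain ⟨b, hb, rfl⟩ := ht'
        rw [hmemBx] at hb
        rw [mem_filter, mem_image]
        refine ⟨⟨b, hb.1, ?_⟩, ?_⟩
        · rw [removeNth_succ_eq_cons, hb.2]
        · rw [hcx]
          exact Fin.cons_zero _ _
      · intro hc
        rw [mem_filter, mem_image] at hc
        obtain ⟨⟨b, hb, rfl⟩, hc0⟩ := hc
        have hb0 : b 0 = x := by simpa [Fin.removeNth] using hc0
        rw [mem_image]
        refine ⟨Fin.removeNth j (Fin.tail b), ?_, ?_⟩
        · rw [hP, mem_image]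
          refine ⟨Fin.tail b, ?_, rfl⟩
          change Fin.tail b ∈ (Bx x).image Fin.tail
          exact mem_image_of_mem _ (hmemBx.2 ⟨hb, hb0⟩)
        · rw [removeNth_succ_eq_cons, hb0]
    have hq_sum : ∀ j, ∑ x ∈ X₀, q j x = #(B.image (Fin.removeNth j.succ)) := by
      intro j
      rw [hq]
      exact (card_eq_sum_card_fiberwise fun c hc => by
        rw [mem_coe, mem_image] at hc
        obtain ⟨b, hb, rfl⟩ := hc
        exact mem_coe.2 (mem_image.2 ⟨b, hb, by simp [Fin.removeNth]⟩)).symm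
    -- the induction hypothesis on each slice, times `|B(x)| ≤ |B_0|`
    have hIH : ∀ x ∈ X₀, #(Tx x) ^ (n + 1) ≤ N₀ * ∏ j ∈ (univ : Finset (Fin (n + 1))), q j x := by
      intro x hx
      have hne : (Tx x).Nonempty := by
        rw [hX₀, mem_image] at hx
        obtain ⟨b, hb, rfl⟩ := hx
        exact ⟨Fin.tail b, mem_image_of_mem _ (hmemBx.2 ⟨hb, rfl⟩)⟩
      have ih := pow_card_le_prod_card_image_removeNth_of_nonempty n (Tx x) hne
      rw [prod_congr rfl fun j _ => hq_eq j x] at ih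
      rw [pow_succ']
      exact Nat.mul_le_mul (hT_le x) ih
    -- Hölder
    have hH := pow_sum_le_mul_prod_sum X₀ (univ : Finset (Fin (n + 1))) (by simp) (Nat.succ_ne_zero n)
      N₀ (fun x => #(Tx x)) q hIH
    rw [hB_sum, Fin.prod_univ_succ]
    simp_rw [← hTB]
    refine hH.trans (le_of_eq ?_)
    rw [prod_congr rfl fun j _ => hq_sum j]

/-- **Discrete Loomis–Whitney inequality (box theorem)** (Gyarmati–Matolcsi–Ruzsa 2010, Lemma 3.1:
"Let `d ≥ 2` be an integer, `X_1, …, X_d` arbitrary sets, `B ⊂ X_1 × ⋯ × X_d` … `B_i` the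
corresponding projection … We have `|B|^{d−1} ≤ ∏_{i=1}^d |B_i|`"; Loomis–Whitney 1949, Han 1978,
Bollobás–Thomason 1995).  Here `d = n + 1 ≥ 2`, all factors equal to one type `X` (no loss: embed
`X_1, …, X_d` in their disjoint union), `B ⊆ X^{n+1}` as `Finset (Fin (n+1) → X)`, and
`B_i = B.image (Fin.removeNth i)`.  The case `d = 3` in product-type clothing is
`card_sq_le_card_proj_mul` above. [cite: GyarmatiMatolcsiRuzsa2010, Lemma 3.1] -/
theorem pow_card_le_prod_card_image_removeNth {n : ℕ} (hn : 1 ≤ n) (B : Finset (Fin (n + 1) → X)) :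
    #B ^ n ≤ ∏ i : Fin (n + 1), #(B.image (Fin.removeNth i)) := by
  rcases B.eq_empty_or_nonempty with rfl | hB
  · rw [card_empty, zero_pow (by omega)]
    exact Nat.zero_le _
  · exact pow_card_le_prod_card_image_removeNth_of_nonempty n B hB

/-- Transport of a lexicographic comparison along a common coordinate: if `x < y`
lexicographically and `x j = y j`, then replacing the common `j`-th entry by any `a` preserves `<`.
[folklore] -/
private theorem toLex_update_lt_toLex_update {ι : Type*} [LinearOrder ι] {β : Type*} [PartialOrder β]
    {x y : ι → β} {j : ι} (hxy : toLex x < toLex y) (hj : x j = y j) (a : β) :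
    toLex (Function.update x j a) < toLex (Function.update y j a) := by
  obtain ⟨i, hlt, hi⟩ := hxy
  dsimp at hlt hi
  have hij : i ≠ j := by
    rintro rfl
    rw [hj] at hi
    exact lt_irrefl _ hi
  refine ⟨i, fun j' hj' => ?_, ?_⟩
  · dsimp
    by_cases h : j' = j
    · subst h
      rw [Function.update_self, Function.update_self]
    · rw [Function.update_of_ne h, Function.update_of_ne h]
      exact hlt j' hj'
  · dsimp
    rw [Function.update_of_ne hij, Function.update_of_ne hij]
    exact hi

end LoomisWhitney

/-! ### Theorem 1.2 for `k` summands -/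

section Submultiplicativity

open LoomisWhitney
open scoped Pointwise

variable {α : Type*} [AddCommMonoid α] [DecidableEq α]

/-- Membership in a pointwise sum of finitely many finsets. [folklore] -/
private theorem mem_fintype_sum_iff {ι : Type*} [Fintype ι] (A : ι → Finset α) (a : α) :
    a ∈ ∑ i, A i ↔ ∃ g : ι → α, (∀ i, g i ∈ A i) ∧ ∑ i, g i = a := by
  rw [← mem_coe, coe_sum, Set.mem_fintype_sum]
  simp only [mem_coe, exists_prop]

/-- **Gyarmati–Matolcsi–Ruzsa 2010, Theorem 1.2 (submultiplicativity), any number of summands.**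
"Let `A_1, …, A_k` be finite, nonempty sets in an arbitrary commutative semigroup.  Put
`S = A_1 + ⋯ + A_k`, `S_i = A_1 + ⋯ + A_{i−1} + A_{i+1} + ⋯ + A_k`.  We have
`|S| ≤ (∏_{i=1}^k |S_i|)^{1/(k−1)}`."  Here `k = n + 1`, the sets are indexed by `Fin (n + 1)`,
`S_i = ∑_j A_{i.succAbove j}`, and the inequality is written `|S|^n ≤ ∏_i |S_i|`; the ambient
structure is an additive commutative monoid (a commutative semigroup embeds in one by adjoining a
zero, so this is no restriction).  Proof as printed (§3): `f(s) =` the lexicographically least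
representation of `s` (for a fixed enumeration of `⋃ A_i`), `B = f(S) ⊆ A_1 × ⋯ × A_k` has
`|B| = |S|`, Lemma 3.1 (`pow_card_le_prod_card_image_removeNth_of_nonempty`) bounds `|B|^{k−1}` by
the projections, and on each projection `B_j` the coordinate sum is injective (a collision yields a
lexicographically smaller representation).  The case `k = 3` in `A + B + C` clothing is
`card_add_add_sq_le` above. [cite: GyarmatiMatolcsiRuzsa2010, Thm 1.2] -/
theorem pow_card_sum_le_prod_card_sum_succAbove {n : ℕ} (A : Fin (n + 1) → Finset α)
    (hA : ∀ i, (A i).Nonempty) :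
    #(∑ i, A i) ^ n ≤ ∏ i : Fin (n + 1), #(∑ j : Fin n, A (i.succAbove j)) := by
  classical
  -- an enumeration of `⋃ A_i`
  set U : Finset α := univ.biUnion A with hU
  set rk : α → ℕ := fun u => if h : u ∈ U then (U.equivFin ⟨u, h⟩ : ℕ) else 0 with hrk
  have hrk_inj : ∀ {u v}, u ∈ U → v ∈ U → rk u = rk v → u = v := by
    intro u v hu hv h
    simp only [hrk, dif_pos hu, dif_pos hv] at h
    have := (U.equivFin).injective (Fin.ext h)
    exact congrArg Subtype.val this
  have hAU : ∀ {i a}, a ∈ A i → a ∈ U := fun {i a} h => by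
    rw [hU, mem_biUnion]
    exact ⟨i, mem_univ _, h⟩
  -- representations and the lexicographically least one
  set S := ∑ i, A i with hS
  set R : α → Finset (Fin (n + 1) → α) :=
    fun s => (Fintype.piFinset A).filter fun r => ∑ i, r i = s with hR
  have hmemR : ∀ {s r}, r ∈ R s ↔ (∀ i, r i ∈ A i) ∧ ∑ i, r i = s := by
    intro s r
    rw [hR, mem_filter, Fintype.mem_piFinset]
  have hRne : ∀ s ∈ S, (R s).Nonempty := by
    intro s hs
    obtain ⟨g, hg, hgs⟩ := (mem_fintype_sum_iff A s).1 hs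
    exact ⟨g, hmemR.2 ⟨hg, hgs⟩⟩
  set key : (Fin (n + 1) → α) → Lex (Fin (n + 1) → ℕ) := fun r => toLex fun i => rk (r i) with hkey
  have hex : ∀ s ∈ S, ∃ r ∈ R s, ∀ r' ∈ R s, key r ≤ key r' :=
    fun s hs => exists_min_image (R s) key (hRne s hs)
  choose! f hfR hfmin using hex
  have hf : ∀ s ∈ S, (∀ i, f s i ∈ A i) ∧ ∑ i, f s i = s := fun s hs => hmemR.1 (hfR s hs)
  -- `key` is injective on vectors with entries in `U`
  have hkey_inj : ∀ {r r' : Fin (n + 1) → α}, (∀ i, r i ∈ U) → (∀ i, r' i ∈ U) →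
      key r = key r' → r = r' := by
    intro r r' hr hr' h
    funext i
    have hi : rk (r i) = rk (r' i) := by
      have := congrArg (fun v : Lex (Fin (n + 1) → ℕ) => (ofLex v) i) h
      simpa [hkey] using this
    exact hrk_inj (hr i) (hr' i) hi
  have hkey_update : ∀ (r : Fin (n + 1) → α) (j : Fin (n + 1)) (a : α),
      key (Function.update r j a) = toLex (Function.update (fun i => rk (r i)) j (rk a)) := by
    intro r j a
    simp only [hkey]
    congr 1
    funext i
    exact Function.apply_update (fun _ => rk) r j a i
  -- `B = f(S)` has `|B| = |S|`
  set B := S.image f with hB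
  have hBcard : #B = #S := by
    rw [hB, card_image_of_injOn fun s hs s' hs' h => ?_]
    rw [← (hf s (mem_coe.1 hs)).2, ← (hf s' (mem_coe.1 hs')).2, h]
  -- on each projection of `B` the coordinate sum is injective, with values in `S_j`
  have hproj : ∀ j : Fin (n + 1),
      #(B.image (Fin.removeNth j)) ≤ #(∑ i : Fin n, A (j.succAbove i)) := by
    intro j
    refine card_le_card_of_injOn (fun z => ∑ i, z i) (fun z hz => ?_) fun z hz z' hz' hzz => ?_
    · rw [mem_coe, mem_image] at hz
      obtain ⟨x, hx, rfl⟩ := hz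
      rw [hB, mem_image] at hx
      obtain ⟨s, hs, rfl⟩ := hx
      exact mem_coe.2 ((mem_fintype_sum_iff _ _).2 ⟨fun i => f s (j.succAbove i),
        fun i => (hf s hs).1 _, rfl⟩)
    · rw [mem_coe, mem_image] at hz hz'
      obtain ⟨x, hx, rfl⟩ := hz
      obtain ⟨y, hy, rfl⟩ := hz'
      rw [hB, mem_image] at hx hy
      obtain ⟨s, hs, rfl⟩ := hx
      obtain ⟨s', hs', rfl⟩ := hy
      change ∑ i, f s (j.succAbove i) = ∑ i, f s' (j.succAbove i) at hzz
      by_contra hne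
      obtain ⟨hxA, hxs⟩ := hf s hs
      obtain ⟨hyA, hys⟩ := hf s' hs'
      -- the mixed representations
      set x' := Function.update (f s) j (f s' j) with hx'
      set y' := Function.update (f s') j (f s j) with hy'
      have hsum_x' : ∑ i, x' i = s' := by
        have e : ∑ i, x' (j.succAbove i) = ∑ i, f s' (j.succAbove i) := by
          rw [← hzz]
          exact sum_congr rfl fun i _ => by rw [hx', Function.update_of_ne (Fin.succAbove_ne j i)]
        rw [Fin.sum_univ_succAbove _ j, e, hx', Function.update_self, ← Fin.sum_univ_succAbove (f s') j,
          hys]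
      have hsum_y' : ∑ i, y' i = s := by
        have e : ∑ i, y' (j.succAbove i) = ∑ i, f s (j.succAbove i) := by
          rw [hzz]
          exact sum_congr rfl fun i _ => by rw [hy', Function.update_of_ne (Fin.succAbove_ne j i)]
        rw [Fin.sum_univ_succAbove _ j, e, hy', Function.update_self, ← Fin.sum_univ_succAbove (f s) j,
          hxs]
      have hx'R : x' ∈ R s' := by
        refine hmemR.2 ⟨fun i => ?_, hsum_x'⟩
        by_cases h : i = j
        · subst h; rw [hx', Function.update_self]; exact hyA i
        · rw [hx', Function.update_of_ne h]; exact hxA i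
      have hy'R : y' ∈ R s := by
        refine hmemR.2 ⟨fun i => ?_, hsum_y'⟩
        by_cases h : i = j
        · subst h; rw [hy', Function.update_self]; exact hxA i
        · rw [hy', Function.update_of_ne h]; exact hyA i
      have hx'U : ∀ i, x' i ∈ U := fun i => hAU ((hmemR.1 hx'R).1 i)
      have hyU : ∀ i, f s' i ∈ U := fun i => hAU (hyA i)
      -- `x' ≠ f s'` since their `j`-deleted parts differ
      have hx'ne : x' ≠ f s' := by
        intro h
        apply hne
        have := congrArg (Fin.removeNth j) h
        rwa [hx', Fin.removeNth_update] at this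
      have hkeyne : key x' ≠ key (f s') := fun h => hx'ne (hkey_inj hx'U hyU h)
      rcases lt_or_gt_of_ne hkeyne with hlt | hlt
      · exact absurd (hfmin s' hs' x' hx'R) (not_le.2 hlt)
      · -- transport along the common coordinate `j` (value `f s' j`) to the value `f s j`
        have hj : (fun i => rk (f s' i)) j = (fun i => rk (x' i)) j := by
          simp only [hx', Function.update_self]
        have ht := toLex_update_lt_toLex_update (x := fun i => rk (f s' i)) (y := fun i => rk (x' i))
          (by simpa [hkey] using hlt) hj (rk (f s j))
        rw [← hkey_update, ← hkey_update] at ht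
        have e1 : Function.update x' j (f s j) = f s := by
          rw [hx', Function.update_idem, Function.update_eq_self]
        rw [e1, ← hy'] at ht
        exact absurd (hfmin s hs y' hy'R) (not_le.2 ht)
  -- Lemma 3.1
  have hSne : S.Nonempty := by
    obtain ⟨g, hg⟩ : ∃ g : Fin (n + 1) → α, ∀ i, g i ∈ A i := ⟨fun i => (hA i).choose, fun i => (hA i).choose_spec⟩
    exact ⟨∑ i, g i, (mem_fintype_sum_iff A _).2 ⟨g, hg, rfl⟩⟩
  have hBne : B.Nonempty := hSne.image f
  have hLW := pow_card_le_prod_card_image_removeNth_of_nonempty n B hBne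
  rw [hBcard] at hLW
  exact hLW.trans (prod_le_prod' fun j _ => hproj j)

/-- Theorem 1.2 with `S_i` written as the sum over `j ≠ i`:
`|∑_i A_i|^n ≤ ∏_i |∑_{j ≠ i} A_j|` for `n + 1` nonempty finsets. [cite: GyarmatiMatolcsiRuzsa2010, Thm 1.2] -/
theorem pow_card_sum_le_prod_card_sum_erase {n : ℕ} (A : Fin (n + 1) → Finset α)
    (hA : ∀ i, (A i).Nonempty) :
    #(∑ i, A i) ^ n ≤ ∏ i : Fin (n + 1), #(∑ j ∈ ({i}ᶜ : Finset (Fin (n + 1))), A j) := by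
  have h := pow_card_sum_le_prod_card_sum_succAbove A hA
  refine h.trans (le_of_eq (prod_congr rfl fun i _ => ?_))
  rw [← Fin.image_succAbove_univ, sum_image fun a _ b _ hab => Fin.succAbove_right_injective hab]

end Submultiplicativity


end Literature.Combinatorics.Additive
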